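import Mathlib.Data.Nat.Bitwise
import Mathlib.Data.Fin.VecNotation
import Mathlib.Logic.Equiv.Fin.Basic
import Mathlib.Data.Fintype.Basic
import Mathlib.Data.Fintype.Prod
import Mathlib.Data.Fintype.Pi
import Mathlib.Tactic.FinCases
import Mathlib.Tactic.NormNum

/-!
# Zero patterns of `Sing(per₄)` — the finite cover (kernel-decided) and its decoding

Companion of `SymPencilPerFourSingularLocusSupportMonomials` (the two monomial members
`12·x₀₂x₀₃x₁₁³x₂₀x₃₀³`, `12·x₀₀x₀₁x₀₃x₁₂²x₂₁²x₃₀²` of the ideal `J₃(X₄)` of the sixteen `3 × 3`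
sub-permanents of a `4 × 4` matrix) and input of `SymPencilPerFourSingularLocusSupportPatterns`
(the support theorem: a `4 × 4` matrix over a domain with `12 ≠ 0` all of whose `3 × 3`
sub-permanents vanish has a zero row, a zero column, an anti-block zero pattern or cross support).

This file is pure finite combinatorics on 16-bit masks `z` (bit `4 i + j` ↔ cell `(i, j)`):

* `termGen` — the 42 TERMINAL patterns (4 rows, 4 columns, 18 anti-blocks `I × J ∪ Iᶜ × Jᶜ`,
  16 cross complements `([4]∖i₀) × ([4]∖j₀)`), generated from parameters, with their semantics
  (`termSem_of_mem_termGen`);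
* `imageMasks` — the 720 images of the monomial supports `U₁ = {02,03,11,20,30}` (144 images),
  `U₂ = {00,01,03,12,21,30}` and its transpose (288 images each) under row and column permutations,
  computed in the kernel from `perms4` (one representative per stabiliser coset, see `witParams`);
* `ok z` — «`z` contains a terminal pattern, or is disjoint from an image»;
* `checkSorted_eq` — ONE `decide +kernel` (≈ 20 s): `ok z` for every pattern `z` whose row
  zero-counts and column zero-counts are both non-decreasing (1 526 of the 65 536 patterns; every
  matrix is brought to this normal form by sorting rows and columns, which preserves the hypothesis);
  the enumeration runs over nibbles `r₃, r₂, r₁, r₀` with popcount guards, so only the 10 121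
  row-sorted patterns are ever formed;
* `ok_of_sorted` — the arithmetic read-back `∀ z < 65536, sortedB z → ok z`.

Helper for crux `CoverDecancellation` (stmt-ValiantsHypothesis-17819), rung `StrengthTwoPerFourGeFour`
(«str₂(per₄) ≥ 4» ⇐ «codim Sing(per₄) ≥ 7»); closes `stub_noZeroLine_zeros` of the line
`Cruxes/CoverDecancellation/Lines/sing_height_cascade.lean` together with the Patterns file.
val-idea-10 g2, 2026-08-28 (RULING g12-R132 (a): one `decide` under 60 s).  No `sorry`,
no `native_decide`; the `def`s are bookkeeping on masks, no mathematical notion is introduced.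
-/

set_option linter.dupNamespace false

namespace Summit.ValiantsHypothesis.ValiantsHypothesis.Theorems.SymPencilPerFourSingularLocusSupportCover

/-! ## §1 Masks -/

/-- Bit index of a cell. -/
def bitIdx (c : Fin 4 × Fin 4) : ℕ := 4 * (c.1 : ℕ) + (c.2 : ℕ)

/-- The mask of a list of cells. -/
def maskOf (l : List (Fin 4 × Fin 4)) : ℕ := l.foldr (fun c acc => 2 ^ bitIdx c ||| acc) 0

/-- The sixteen cells, listed. -/
def allCells : List (Fin 4 × Fin 4) :=
  [(0,0),(0,1),(0,2),(0,3),(1,0),(1,1),(1,2),(1,3),(2,0),(2,1),(2,2),(2,3),(3,0),(3,1),(3,2),(3,3)]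

/-- Every cell is listed in `allCells`. -/
theorem mem_allCells (c : Fin 4 × Fin 4) : c ∈ allCells := by
  revert c; decide

/-- Row, column, anti-block and cross-complement patterns as masks. -/
def rowMask (i : Fin 4) : ℕ := maskOf [(i,0),(i,1),(i,2),(i,3)]
/-- Column pattern. -/
def colMask (j : Fin 4) : ℕ := maskOf [(0,j),(1,j),(2,j),(3,j)]
/-- Anti-block pattern `I × J ∪ Iᶜ × Jᶜ`, `I = {i₁, i₂}`, `J = {j₁, j₂}`. -/
def antiMask (i₁ i₂ j₁ j₂ : Fin 4) : ℕ :=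
  maskOf (allCells.filter fun c => decide ((c.1 = i₁ ∨ c.1 = i₂) ↔ (c.2 = j₁ ∨ c.2 = j₂)))
/-- Cross-complement pattern `([4]∖i₀) × ([4]∖j₀)`. -/
def crossMask (i₀ j₀ : Fin 4) : ℕ :=
  maskOf (allCells.filter fun c => decide (c.1 ≠ i₀ ∧ c.2 ≠ j₀))

/-- Parameters `(i₁, i₂, j₁, j₂)` of the 18 anti-block patterns (with `0 ∈ I`). -/
def antiParams : List (Fin 4 × Fin 4 × Fin 4 × Fin 4) :=
  [(0,1,0,1),(0,1,0,2),(0,1,0,3),(0,1,1,2),(0,1,1,3),(0,1,2,3),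
   (0,2,0,1),(0,2,0,2),(0,2,0,3),(0,2,1,2),(0,2,1,3),(0,2,2,3),
   (0,3,0,1),(0,3,0,2),(0,3,0,3),(0,3,1,2),(0,3,1,3),(0,3,2,3)]

/-- The anti-block parameters are pairs of distinct indices. -/
theorem antiParams_ne : ∀ p ∈ antiParams, p.1 ≠ p.2.1 ∧ p.2.2.1 ≠ p.2.2.2 := by
  unfold antiParams; decide +kernel

/-- The 42 terminal masks. -/
def termGen : List ℕ :=
  [rowMask 0, rowMask 1, rowMask 2, rowMask 3] ++ [colMask 0, colMask 1, colMask 2, colMask 3] ++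
    antiParams.map (fun p => antiMask p.1 p.2.1 p.2.2.1 p.2.2.2) ++
    allCells.map (fun c => crossMask c.1 c.2)

/-- The 24 permutations of `Fin 4` in lexicographic order (consecutive pairs differ by the
transposition of the last two values). -/
def perms4 : List (Fin 4 → Fin 4) := [![0, 1, 2, 3], ![0, 1, 3, 2], ![0, 2, 1, 3], ![0, 2, 3, 1], ![0, 3, 1, 2], ![0, 3, 2, 1], ![1, 0, 2, 3], ![1, 0, 3, 2], ![1, 2, 0, 3], ![1, 2, 3, 0], ![1, 3, 0, 2], ![1, 3, 2, 0], ![2, 0, 1, 3], ![2, 0, 3, 1], ![2, 1, 0, 3], ![2, 1, 3, 0], ![2, 3, 0, 1], ![2, 3, 1, 0], ![3, 0, 1, 2], ![3, 0, 2, 1], ![3, 1, 0, 2], ![3, 1, 2, 0], ![3, 2, 0, 1], ![3, 2, 1, 0]]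

/-- Every entry of `perms4` is a bijection. -/
theorem perms4_bijective : ∀ σ ∈ perms4, Function.Bijective σ := by
  unfold perms4; decide +kernel

/-- Supports: `U₁` (`0`), `U₂` (`1`) and the transpose `U₂ᵀ` (`2`). -/
def baseCells : ℕ → List (Fin 4 × Fin 4)
  | 0 => [(0,2),(0,3),(1,1),(2,0),(3,0)]
  | 1 => [(0,0),(0,1),(0,3),(1,2),(2,1),(3,0)]
  | _ => [(0,0),(1,0),(3,0),(2,1),(1,2),(0,3)]

/-- Where the reindexed matrix `M.submatrix σ τ` reads `M`. -/
def imgCell (σ τ : Fin 4 → Fin 4) (c : Fin 4 × Fin 4) : Fin 4 × Fin 4 := (σ c.1, τ c.2)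

/-- Witness parameters `(a, b, k)`: row / column permutation indices and which support.  The parity
conditions pick one representative per coset of the stabiliser (`U₁`: rows `2↔3` and columns
`2↔3`, 144 images; `U₂`: `(rows 2↔3, cols 0↔1)`, 288 images; `U₂ᵀ`: `(rows 0↔1, cols 2↔3)`,
288 images) — 720 distinct images in all. -/
def witParams : List (ℕ × ℕ × ℕ) :=
  (List.range 24).flatMap fun a => (List.range 24).flatMap fun b =>
    (bif (a % 2 == 0 && b % 2 == 0) then [(a, b, 0)] else []) ++
    (bif (a % 2 == 0) then [(a, b, 1)] else []) ++ (bif (b % 2 == 0) then [(a, b, 2)] else [])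

/-- The image mask of a witness. -/
def witMask (w : ℕ × ℕ × ℕ) : ℕ :=
  maskOf ((baseCells w.2.2).map (imgCell (perms4.getD w.1 id) (perms4.getD w.2.1 id)))

/-- The 720 image masks. -/
def imageMasks : List ℕ := witParams.map witMask

/-- Witness indices are `< 24`. -/
theorem witParams_lt : witParams.all (fun w => decide (w.1 < 24) && decide (w.2.1 < 24)) = true := by
  decide +kernel

/-- The cover predicate: `z` contains a terminal pattern or misses an image. -/
def ok (z : ℕ) : Bool :=
  termGen.any (fun m => z &&& m == m) || imageMasks.any (fun u => z &&& u == 0)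

/-! ## §2 The cover check on count-sorted patterns (one kernel `decide`) -/

/-- Popcount of a nibble; row and column zero-counts of a mask. -/
def pc (n : ℕ) : ℕ := (n.testBit 0).toNat + (n.testBit 1).toNat + (n.testBit 2).toNat + (n.testBit 3).toNat
/-- Row zero-count of a mask. -/
def rcnt (z i : ℕ) : ℕ :=
  (z.testBit (0 + 4 * i)).toNat + (z.testBit (1 + 4 * i)).toNat + (z.testBit (2 + 4 * i)).toNat +
    (z.testBit (3 + 4 * i)).toNat
/-- Column zero-count of a mask. -/
def ccnt (z j : ℕ) : ℕ :=
  (z.testBit (j + 4 * 0)).toNat + (z.testBit (j + 4 * 1)).toNat + (z.testBit (j + 4 * 2)).toNat +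
    (z.testBit (j + 4 * 3)).toNat

/-- «row zero-counts and column zero-counts are non-decreasing». -/
def sortedB (z : ℕ) : Bool :=
  decide (rcnt z 0 ≤ rcnt z 1) && decide (rcnt z 1 ≤ rcnt z 2) && decide (rcnt z 2 ≤ rcnt z 3) &&
  (decide (ccnt z 0 ≤ ccnt z 1) && decide (ccnt z 1 ≤ ccnt z 2) && decide (ccnt z 2 ≤ ccnt z 3))

/-- A mask from its four nibbles. -/
def z4 (r0 r1 r2 r3 : ℕ) : ℕ := r0 + 16 * (r1 + 16 * (r2 + 16 * r3))

/-- The guarded enumeration (guards only prune; the leaf re-tests `sortedB`). -/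
def checkSorted : Bool :=
  (List.range 16).all fun r3 => (List.range 16).all fun r2 => !(decide (pc r2 ≤ pc r3)) ||
    (List.range 16).all fun r1 => !(decide (pc r1 ≤ pc r2)) ||
      (List.range 16).all fun r0 => !(decide (pc r0 ≤ pc r1)) ||
        (!(sortedB (z4 r0 r1 r2 r3)) || ok (z4 r0 r1 r2 r3))

set_option maxHeartbeats 4000000 in
/-- **The cover fact** (kernel): every count-sorted zero pattern contains a terminal pattern or
misses one of the 720 images of `U₁`, `U₂`. -/
theorem checkSorted_eq : checkSorted = true := by
  decide +kernel

/-! ## §3 Reading the cover fact back -/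

/-- Discharging a Boolean guard. -/
theorem of_guard {a b : Bool} (h : (!a || b) = true) (ha : a = true) : b = true := by
  cases a <;> simp_all

/-- Row counts are popcounts of base-16 digits. -/
theorem rcnt_eq_pc (z i : ℕ) : rcnt z i = pc (z / 2 ^ (4 * i) % 2 ^ 4) := by
  simp only [rcnt, pc, Nat.testBit_mod_two_pow, Nat.testBit_div_two_pow]
  simp only [show (0:ℕ) < 4 by norm_num, show (1:ℕ) < 4 by norm_num, show (2:ℕ) < 4 by norm_num,
    show (3:ℕ) < 4 by norm_num, decide_true, Bool.true_and]

/-- `ok z` for every count-sorted pattern `z < 2¹⁶`. -/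
theorem ok_of_sorted (z : ℕ) (hz : z < 65536) (hs : sortedB z = true) : ok z = true := by
  have h0 : rcnt z 0 = pc (z % 16) := by rw [rcnt_eq_pc]; norm_num
  have h1 : rcnt z 1 = pc (z / 16 % 16) := by rw [rcnt_eq_pc]; norm_num
  have h2 : rcnt z 2 = pc (z / 256 % 16) := by rw [rcnt_eq_pc]; norm_num
  have h3 : rcnt z 3 = pc (z / 4096 % 16) := by rw [rcnt_eq_pc]; norm_num
  have hs' := hs
  simp only [sortedB, Bool.and_eq_true, decide_eq_true_eq] at hs'
  obtain ⟨⟨⟨h01, h12⟩, h23⟩, -⟩ := hs'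
  rw [h0, h1] at h01; rw [h1, h2] at h12; rw [h2, h3] at h23
  have e : z4 (z % 16) (z / 16 % 16) (z / 256 % 16) (z / 4096 % 16) = z := by unfold z4; omega
  have rd : ∀ {f : ℕ → Bool}, (List.range 16).all f = true → ∀ {r : ℕ}, r % 16 = r → f r = true :=
    fun h r hr => List.all_eq_true.1 h r (List.mem_range.2 (by omega))
  have A := rd checkSorted_eq (Nat.mod_mod (z / 4096) 16)
  have B := of_guard (rd A (Nat.mod_mod _ _)) (decide_eq_true h23)
  have C := of_guard (rd B (Nat.mod_mod _ _)) (decide_eq_true h12)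
  have D := of_guard (rd C (Nat.mod_mod _ _)) (decide_eq_true h01)
  rw [e] at D
  exact of_guard D hs

/-! ## §4 Decoding masks -/

/-- Bits of `maskOf`. -/
theorem testBit_maskOf (l : List (Fin 4 × Fin 4)) (e : ℕ) :
    (maskOf l).testBit e = true ↔ ∃ c ∈ l, bitIdx c = e := by
  induction l with
  | nil => simp [maskOf]
  | cons c l ih =>
      simp only [maskOf, List.foldr_cons] at ih ⊢
      rw [Nat.testBit_or, Bool.or_eq_true, Nat.testBit_two_pow, ih]
      simp

/-- `bitIdx` is injective. -/
theorem bitIdx_injective : Function.Injective bitIdx := by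
  intro c c' h; revert c c' ; decide

/-- `bitIdx < 16`. -/
theorem bitIdx_lt (c : Fin 4 × Fin 4) : bitIdx c < 16 := by
  unfold bitIdx; omega

/-- Bits of a sub-mask. -/
theorem testBit_of_and_eq_self {z m : ℕ} (h : z &&& m = m) (e : ℕ) (he : m.testBit e = true) :
    z.testBit e = true := by
  have := congrArg (fun n => Nat.testBit n e) h
  simp only [Nat.testBit_and] at this
  rw [he] at this
  simpa using this

/-- Bits of a disjoint mask. -/
theorem testBit_of_and_eq_zero {z u : ℕ} (h : z &&& u = 0) (e : ℕ) (he : u.testBit e = true) :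
    z.testBit e = false := by
  have := congrArg (fun n => Nat.testBit n e) h
  simp only [Nat.testBit_and, Nat.zero_testBit] at this
  rw [he] at this
  simpa using this

/-- Semantics of a terminal mask: the cells it prescribes contain a row, a column, an anti-block
or a cross complement. -/
theorem termSem_of_mem_termGen {m : ℕ} (hm : m ∈ termGen) :
    (∃ i : Fin 4, ∀ j : Fin 4, m.testBit (bitIdx (i, j)) = true) ∨
    (∃ j : Fin 4, ∀ i : Fin 4, m.testBit (bitIdx (i, j)) = true) ∨
    (∃ i₁ i₂ j₁ j₂ : Fin 4, i₁ ≠ i₂ ∧ j₁ ≠ j₂ ∧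
        ∀ i j : Fin 4, ((i = i₁ ∨ i = i₂) ↔ (j = j₁ ∨ j = j₂)) → m.testBit (bitIdx (i, j)) = true) ∨
    (∃ i₀ j₀ : Fin 4, ∀ i j : Fin 4, i ≠ i₀ → j ≠ j₀ → m.testBit (bitIdx (i, j)) = true) := by
  simp only [termGen, List.mem_append, List.mem_cons, List.mem_map, List.not_mem_nil, or_false]
    at hm
  rcases hm with ((hrow | hcol) | ⟨p, hp, rfl⟩) | ⟨c, -, rfl⟩
  · have aux : ∀ i j : Fin 4, (rowMask i).testBit (bitIdx (i, j)) = true := fun i j =>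
      (testBit_maskOf _ _).2 ⟨(i, j), by fin_cases j <;> simp, rfl⟩
    rcases hrow with rfl | rfl | rfl | rfl <;> exact Or.inl ⟨_, aux _⟩
  · have aux : ∀ j i : Fin 4, (colMask j).testBit (bitIdx (i, j)) = true := fun j i =>
      (testBit_maskOf _ _).2 ⟨(i, j), by fin_cases i <;> simp, rfl⟩
    rcases hcol with rfl | rfl | rfl | rfl <;> exact Or.inr (Or.inl ⟨_, aux _⟩)
  · obtain ⟨h1, h2⟩ := antiParams_ne p hp
    refine Or.inr (Or.inr (Or.inl ⟨p.1, p.2.1, p.2.2.1, p.2.2.2, h1, h2, fun i j hij => ?_⟩))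
    exact (testBit_maskOf _ _).2 ⟨(i, j), List.mem_filter.2 ⟨mem_allCells _, decide_eq_true hij⟩, rfl⟩
  · refine Or.inr (Or.inr (Or.inr ⟨c.1, c.2, fun i j hi hj => ?_⟩))
    exact (testBit_maskOf _ _).2 ⟨(i, j), List.mem_filter.2 ⟨mem_allCells _, decide_eq_true ⟨hi, hj⟩⟩, rfl⟩

/-- Decoding an image mask: a witness `(σ, τ, k)` with bijective `σ, τ`. -/
theorem exists_wit_of_mem_imageMasks {u : ℕ} (hu : u ∈ imageMasks) :
    ∃ (σ τ : Fin 4 → Fin 4) (k : ℕ), Function.Bijective σ ∧ Function.Bijective τ ∧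
      u = maskOf ((baseCells k).map (imgCell σ τ)) := by
  unfold imageMasks at hu
  obtain ⟨w, hw, rfl⟩ := List.mem_map.1 hu
  have hlt := List.all_eq_true.1 witParams_lt w hw
  simp only [Bool.and_eq_true, decide_eq_true_eq] at hlt
  refine ⟨perms4.getD w.1 id, perms4.getD w.2.1 id, w.2.2, ?_, ?_, rfl⟩
  · exact perms4_bijective _ (by
      rw [List.getD_eq_getElem _ _ (by simpa [perms4] using hlt.1)]; exact List.getElem_mem _)
  · exact perms4_bijective _ (by
      rw [List.getD_eq_getElem _ _ (by simpa [perms4] using hlt.2)]; exact List.getElem_mem _)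

end Summit.ValiantsHypothesis.ValiantsHypothesis.Theorems.SymPencilPerFourSingularLocusSupportCover
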